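import Summits.HodgeConjecture.HodgeConjecture.Theorems.VHCAbelianSchemesRoadMoverTrapDefs
import Summits.HodgeConjecture.HodgeConjecture.Theorems.VHCAbelianSchemesRoadExtJumpLocusLinearisedTwist
import Literature.AlgebraicGeometry.HodgeTheory.HomComplexPullbackIso
import Mathlib.Algebra.Homology.HomotopyCategory.Shift
import HarnessLib

/-!
# Road №4 (`VHCAbelianSchemesRoad`), crux stmt-HodgeConjecture-26512 `DiagLocalOfMarkmanPinnedForall` — route «2T», step (iii), shift half:
# THE Ext-JUMP LOCUS IGNORES SHIFTS, `J(E•⟦n⟧) = J(E•)`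

research route conditional on HC_CM; not a corollary; Q11.4-sentence-2 already refuted in dim ≥ 3.

Seat prover-26512-2T-i g0, item (N-5)(α) (offered to director-hodge g18 after R18.28 (3); claim-free; `--supports stmt-HodgeConjecture-26512 --as helper`; 0 new facts).
Print's carrier upstairs is `𝓔 = 𝒢^∨[−1]` with `𝒢 = Φ̃(I_{𝒵_Σ} ⊠ I_{𝒵_C})[−3]` (Markman §9.2; PENCIL-26512-TWOTORSION §2 (iii)): between the Fourier–Mukai image and the carrier sit a
SHIFT and a DUAL. This file removes the shifts from the jump-locus bookkeeping: `τ_x^*•` commutes with the shift of cochain complexes (Mathlib's `CommShift ℤ` structure on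
`Functor.mapHomologicalComplex`, and on `DerivedCategory.Q`), and `Hom_D(X⟦n⟧, Y⟦n⟧⟦k⟧) ≃ Hom_D(X, Y⟦k⟧)` (the shift is an auto-equivalence; Mathlib `shiftEquiv`, `shiftComm`).
The DUAL half (`J(E•^∨) = J(E•)⁻¹`, an anti-equivalence on perfect complexes) is NOT here — it needs the derived dual on bounded vector-bundle complexes, which the tree
holds only at module level (`Modules.dual`, `Biduality`) and as the venture's `𝓗om•(E•, –)`.

* `nonempty_shiftedHom_shift_equiv` — `Hom(X, Y⟦k⟧) ≃ Hom(X⟦n⟧, Y⟦n⟧⟦k⟧)` in any category with a `ℤ`-shift; `subsingleton_shiftedHom_shift_iff`.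
* **`mem_extJumpLocus_shift_iff`** — `x ∈ J(E•⟦n⟧) ↔ x ∈ J(E•)`; `extJumpLocus_shift` — `J(E•⟦n⟧) = J(E•)`.
* §3 (APPEND) the dual half's TRANSLATION part: `inv_mem_extJumpLocus_iff` — `x⁻¹ ∈ J(E•) ↔ ∃ k, Hom_D(Q E•, (Q τ_x^*•E•)⟦k⟧) ≠ 0` (and `mem_extJumpLocus_iff_of_sq_eq_one` at
  two-torsion points); what remains of `J(E•^∨) = J(E•)⁻¹` is the derived-duality anti-equivalence on perfect complexes alone (shelf item (N-5)(β3)).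
* §4 (APPEND) `mem_extJumpLocus_dual_iff_of_duality` — `J(E•^∨) = J(E•)⁻¹` COMPOSED modulo (β3) as a displayed argument, over the chain iso (β1)
  `HodgeTheory.nonempty_pullback_dualComplexUnit_iso` (`Literature/AlgebraicGeometry/HodgeTheory/HomComplexPullbackIso`) and §3.

NOTHING here says (iii), (N-U♭), (N-U), the crux, №4, HC_AV, HC_CM or HC holds; HC_CM HELD, by name only; helper lane (width toward the crux = 0).
References: [cite: Markman2025SecantWeil, §9.2 and §9.3 Rem. 9.3.7] [cite: Mukai1978, §3] [cite: Weibel1994, §10.4 Cor. 10.4.7].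
-/

noncomputable section

-- `TopCat.Presheaf`/`Scheme.Modules` are not reducible (as in Mathlib's `AlgebraicGeometry/Modules/Sheaf.lean`).
set_option backward.isDefEq.respectTransparency false

open CategoryTheory CategoryTheory.Category CategoryTheory.Limits AlgebraicGeometry

universe v u

namespace Summit.HodgeConjecture.HodgeConjecture.Ring2.SemiregularRepresentatives

set_option linter.dupNamespace false -- the cell's namespace repeats the summit name, as in every `Ring2*` file

namespace NowhereDisplaceable

open Literature.AlgebraicGeometry Literature.AlgebraicGeometry.Motives Literature.AlgebraicGeometry.Motives.AbelianVariety
open Summit.HodgeConjecture.HodgeConjecture.Ring2.SemiregularRepresentatives.MoverTrap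

/-! ## §1 Shifting both arguments of a shifted Hom set -/

section Shift

variable {C : Type u} [Category.{v} C] [HasShift C ℤ]

/-- **`Hom(X, Y⟦k⟧) ≃ Hom(X⟦n⟧, Y⟦n⟧⟦k⟧)`**: the shift `⟦n⟧` is an auto-equivalence (fully faithful), followed by `Y⟦k⟧⟦n⟧ ≅ Y⟦n⟧⟦k⟧` (Mathlib `shiftComm`); stated as
`Nonempty` (no definition in this lane). [folklore] -/
theorem nonempty_shiftedHom_shift_equiv (X Y : C) (k n : ℤ) : Nonempty (ShiftedHom X Y k ≃ ShiftedHom (X⟦n⟧) (Y⟦n⟧) k) :=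
  ⟨((shiftEquiv C n).fullyFaithfulFunctor.homEquiv (X := X) (Y := Y⟦k⟧)).trans ((Iso.refl _).homCongr (shiftComm Y k n))⟩

/-- `Hom(X⟦n⟧, Y⟦n⟧⟦k⟧) = 0 ↔ Hom(X, Y⟦k⟧) = 0`. [folklore] -/
theorem subsingleton_shiftedHom_shift_iff (X Y : C) (k n : ℤ) :
    Subsingleton (ShiftedHom (X⟦n⟧) (Y⟦n⟧) k) ↔ Subsingleton (ShiftedHom X Y k) :=
  (nonempty_shiftedHom_shift_equiv X Y k n).some.symm.subsingleton_congr

end Shift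

/-! ## §2 `J(E•⟦n⟧) = J(E•)` -/

/-- **THE Ext-JUMP LOCUS IGNORES SHIFTS**: `x ∈ J(E•⟦n⟧) ↔ x ∈ J(E•)` — `τ_x^*•(E•⟦n⟧) ≅ (τ_x^*•E•)⟦n⟧` (`CommShift` of `mapHomologicalComplex`), `Q` commutes with the shifts,
and §1. (Step (iii) of PENCIL-26512-TWOTORSION, shift half: `J(𝒢[−3]) = J(𝒢)`, `J(𝒢^∨[−1]) = J(𝒢^∨)`.) [cite: Mukai1978, §3] [cite: Markman2025SecantWeil, §9.3 Rem. 9.3.7] -/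
theorem mem_extJumpLocus_shift_iff (A : AbelianVariety ℂ) (E : CochainComplex A.X.left.Modules ℤ) (n : ℤ) (x : A.Points ℂ) :
    x ∈ extJumpLocus A (E⟦n⟧) ↔ x ∈ extJumpLocus A E := by
  letI := HasDerivedCategory.standard A.X.left.Modules
  simp only [extJumpLocus, Set.mem_setOf_eq]
  refine exists_congr fun k => not_congr ?_
  -- `τ_x^*•(E⟦n⟧) ≅ (τ_x^*•E)⟦n⟧` and `Q(K⟦n⟧) ≅ (Q K)⟦n⟧`
  let eτ : translationPullbackComplex A x (E⟦n⟧) ≅ (translationPullbackComplex A x E)⟦n⟧ :=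
    (((Scheme.Modules.pullback (A.translation x).left).mapHomologicalComplex (ComplexShape.up ℤ)).commShiftIso n).app E
  have e₁' : DerivedCategory.Q.obj ((translationPullbackComplex A x E)⟦n⟧) ≅ (DerivedCategory.Q.obj (translationPullbackComplex A x E))⟦n⟧ :=
    ((DerivedCategory.Q (C := A.X.left.Modules)).commShiftIso n).app (translationPullbackComplex A x E)
  have e₁ : DerivedCategory.Q.obj (translationPullbackComplex A x (E⟦n⟧)) ≅ (DerivedCategory.Q.obj (translationPullbackComplex A x E))⟦n⟧ :=
    DerivedCategory.Q.mapIso eτ ≪≫ e₁'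
  have e₂ : DerivedCategory.Q.obj (E⟦n⟧) ≅ (DerivedCategory.Q.obj E)⟦n⟧ := ((DerivedCategory.Q (C := A.X.left.Modules)).commShiftIso n).app E
  rw [(e₁.homCongr ((shiftFunctor _ k).mapIso e₂)).subsingleton_congr]
  exact subsingleton_shiftedHom_shift_iff _ _ k n

/-- **`J(E•⟦n⟧) = J(E•)`** as sets. [cite: Mukai1978, §3] -/
theorem extJumpLocus_shift (A : AbelianVariety ℂ) (E : CochainComplex A.X.left.Modules ℤ) (n : ℤ) :
    extJumpLocus A (E⟦n⟧) = extJumpLocus A E :=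
  Set.ext fun x => mem_extJumpLocus_shift_iff A E n x

/-! ## §3 (APPEND, same seat) Step (iii), dual half — the TRANSLATION part: `x⁻¹ ∈ J(E•)` is detected by Homs from `E•` to its `x`-translate

For the derived dual `E•^∨` one has `τ_x^*(E•^∨) = (τ_x^*E•)^∨` and, by duality, `Hom_D((τ_x^*E•)^∨, E•^∨⟦k⟧) ≅ Hom_D(E•, (τ_x^*E•)⟦k⟧)`; the present section supplies the
remaining, duality-free identification `Hom_D(E•, (τ_x^*E•)⟦k⟧) = 0 ↔ Hom_D(τ_{x⁻¹}^*E•, E•⟦k⟧) = 0` — apply the auto-equivalence `τ_x^*` (`D(τ_x^*)` is an equivalence: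
`Literature.Algebra.Homology.subsingleton_shiftedHom_iff_of_isEquivalence`, p683780) and `τ_x^*•τ_{x⁻¹}^*•E• ≅ E•` (`t_x ≫ t_{x⁻¹} = 𝟙`). So `J(E•^∨) = J(E•)⁻¹` reduces to
the derived-duality anti-equivalence on perfect complexes ALONE (NOT in the tree; recorded as the shelf item (N-5)(β3)); at two-torsion points `x = x⁻¹`. -/

/-- **`τ_x^*•(τ_{x⁻¹}^*•E•) ≅ E•`** (`t_x ≫ t_{x⁻¹} = 𝟙_A`, Mathlib `pullbackComp` ∕ `pullbackCongr` ∕ `pullbackId`, prolonged to complexes). [cite: MumfordAV1970, §4 (p. 41, translations)] -/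
theorem nonempty_translationPullbackComplex_inv_iso (A : AbelianVariety ℂ) (x : A.Points ℂ) (E : CochainComplex A.X.left.Modules ℤ) :
    Nonempty (translationPullbackComplex A x (translationPullbackComplex A x⁻¹ E) ≅ E) := by
  have h : (A.translation x).left ≫ (A.translation x⁻¹).left = 𝟙 A.X.left := by
    rw [← Over.comp_left, AbelianVariety.translation_comp_translation_inv]; rfl
  let e : Scheme.Modules.pullback (A.translation x⁻¹).left ⋙ Scheme.Modules.pullback (A.translation x).left ≅ 𝟭 _ :=
    Scheme.Modules.pullbackComp _ _ ≪≫ Scheme.Modules.pullbackCongr h ≪≫ Scheme.Modules.pullbackId A.X.left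
  exact ⟨(Functor.mapHomologicalComplexCompIso e (ComplexShape.up ℤ) ≪≫ Functor.mapHomologicalComplexIdIso _ _).app E⟩

/-- **`x⁻¹ ∈ J(E•)` IFF SOME Hom FROM `E•` TO ITS `x`-TRANSLATE SURVIVES**: `x⁻¹ ∈ J(E•) ↔ ∃ k, Hom_D(Q E•, (Q τ_x^*•E•)⟦k⟧) ≠ 0` — the duality-free half of
`J(E•^∨) = J(E•)⁻¹` (apply `D(τ_x^*)`, an equivalence, to `Hom_D(Q τ_{x⁻¹}^*•E•, (Q E•)⟦k⟧)` and use `τ_x^*•τ_{x⁻¹}^*•E• ≅ E•`). [cite: Mukai1978, §3] [cite: Weibel1994, §10.4 Cor. 10.4.7] -/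
theorem inv_mem_extJumpLocus_iff (A : AbelianVariety ℂ) (E : CochainComplex A.X.left.Modules ℤ) (x : A.Points ℂ) :
    x⁻¹ ∈ extJumpLocus A E ↔ ∃ k : ℤ,
      letI := HasDerivedCategory.standard A.X.left.Modules
      ¬ Subsingleton (ShiftedHom (DerivedCategory.Q.obj E) (DerivedCategory.Q.obj (translationPullbackComplex A x E)) k) := by
  letI := HasDerivedCategory.standard A.X.left.Modules
  haveI := isEquivalence_pullback_translation A x
  obtain ⟨e⟩ := nonempty_translationPullbackComplex_inv_iso A x E
  simp only [extJumpLocus, Set.mem_setOf_eq]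
  refine exists_congr fun k => not_congr ?_
  rw [← Literature.Algebra.Homology.subsingleton_shiftedHom_iff_of_isEquivalence (Scheme.Modules.pullback (A.translation x).left)
    (translationPullbackComplex A x⁻¹ E) E k]
  exact subsingleton_shiftedHom_congr e (Iso.refl _) k

/-- At a TWO-TORSION point (`x = x⁻¹`): `x ∈ J(E•) ↔ ∃ k, Hom_D(Q E•, (Q τ_x^*•E•)⟦k⟧) ≠ 0`. [cite: Mukai1978, §3] -/
theorem mem_extJumpLocus_iff_of_sq_eq_one (A : AbelianVariety ℂ) (E : CochainComplex A.X.left.Modules ℤ) {x : A.Points ℂ} (hx : x * x = 1) :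
    x ∈ extJumpLocus A E ↔ ∃ k : ℤ,
      letI := HasDerivedCategory.standard A.X.left.Modules
      ¬ Subsingleton (ShiftedHom (DerivedCategory.Q.obj E) (DerivedCategory.Q.obj (translationPullbackComplex A x E)) k) := by
  have hx' : x⁻¹ = x := inv_eq_of_mul_eq_one_right hx
  rw [← inv_mem_extJumpLocus_iff A E x, hx']

/-! ## §4 (APPEND, same seat) Step (iii), dual half — COMPOSED modulo the ONE missing input, DERIVED DUALITY on perfect complexes (shelf item (N-5)(β3))

`E•^∨ := 𝓗om•(E•, 𝒪[0])` (`HodgeTheory.homComplex`). The chain isomorphism `τ_x^*•(E•^∨) ≅ (τ_x^*•E•)^∨` is the tree theorem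
`HodgeTheory.nonempty_pullback_dualComplexUnit_iso` (probe (β1), `Literature/AlgebraicGeometry/HodgeTheory/HomComplexPullbackIso`); the translation half is §3 (β2). The
remaining input, displayed here as an ARGUMENT of the exact shape (not a named fact): (β3) DERIVED DUALITY for the pair `(E•, τ_x^*•E•)` —
`Hom_D(Q((τ_x^*•E•)^∨), Q(E•^∨)⟦k⟧) ≃ Hom_D(Q E•, Q(τ_x^*•E•)⟦k⟧)` for every `k` (the anti-equivalence `A ↦ A^∨` of perfect complexes, `(A^∨)^∨ ≅ A`; NOT in the tree:
`Modules/Biduality` is module-level; size L). -/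

/-- **`J(E•^∨) = J(E•)⁻¹` MODULO DERIVED DUALITY**: for `E•` with finite locally free terms on a complex abelian variety and `x ∈ A(ℂ)`, GRANTED the duality bijections
`Hom_D(Q((τ_x^*•E•)^∨), Q(E•^∨)⟦k⟧) ≃ Hom_D(Q E•, Q(τ_x^*•E•)⟦k⟧)` (`E•^∨ := 𝓗om•(E•, 𝒪[0])`; displayed ARGUMENT = shelf item (N-5)(β3)), `x ∈ J(E•^∨) ↔ x⁻¹ ∈ J(E•)`:
(β1) `τ_x^*•(E•^∨) ≅ (τ_x^*•E•)^∨`, (β3), (β2) `inv_mem_extJumpLocus_iff`. At two-torsion points `x = x⁻¹` this is step (iii)'s dual for print's `𝓔 = 𝒢^∨[−1]`.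
[cite: Mukai1978, §3] [cite: Markman2025SecantWeil, §9.2 and §9.3 Rem. 9.3.7] [cite: GortzWedhorn2020, Exercise 7.20 (a)] -/
theorem mem_extJumpLocus_dual_iff_of_duality (A : AbelianVariety ℂ) (E : CochainComplex A.X.left.Modules ℤ) (hE : ∀ i, IsFiniteLocallyFree (E.X i))
    (x : A.Points ℂ)
    (hdual : ∀ k : ℤ, letI := HasDerivedCategory.standard A.X.left.Modules
      Nonempty (ShiftedHom
          (DerivedCategory.Q.obj (HodgeTheory.homComplex A.X.left (translationPullbackComplex A x E)
            ((HomologicalComplex.single A.X.left.Modules (ComplexShape.up ℤ) 0).obj (Modules.unitModule A.X.left))))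
          (DerivedCategory.Q.obj (HodgeTheory.homComplex A.X.left E
            ((HomologicalComplex.single A.X.left.Modules (ComplexShape.up ℤ) 0).obj (Modules.unitModule A.X.left)))) k ≃
        ShiftedHom (DerivedCategory.Q.obj E) (DerivedCategory.Q.obj (translationPullbackComplex A x E)) k)) :
    x ∈ extJumpLocus A (HodgeTheory.homComplex A.X.left E ((HomologicalComplex.single A.X.left.Modules (ComplexShape.up ℤ) 0).obj (Modules.unitModule A.X.left))) ↔
      x⁻¹ ∈ extJumpLocus A E := by
  letI := HasDerivedCategory.standard A.X.left.Modules
  obtain ⟨e⟩ := HodgeTheory.nonempty_pullback_dualComplexUnit_iso (A.translation x).left E hE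
  rw [inv_mem_extJumpLocus_iff]
  simp only [extJumpLocus, Set.mem_setOf_eq]
  refine exists_congr fun k => not_congr ?_
  rw [subsingleton_shiftedHom_congr e (Iso.refl _) k]
  exact (hdual k).some.subsingleton_congr

/-- **At a two-torsion point, step (iii)'s dual half modulo derived duality**: `x * x = 1` ⟹ (`x ∈ J(E•^∨) ↔ x ∈ J(E•)`), granted (β3) for `(E•, τ_x^*•E•)`.
[cite: Mukai1978, §3] [cite: Markman2025SecantWeil, §9.3 Rem. 9.3.7] -/
theorem mem_extJumpLocus_dual_iff_of_duality_of_sq_eq_one (A : AbelianVariety ℂ) (E : CochainComplex A.X.left.Modules ℤ)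
    (hE : ∀ i, IsFiniteLocallyFree (E.X i)) {x : A.Points ℂ} (hx : x * x = 1)
    (hdual : ∀ k : ℤ, letI := HasDerivedCategory.standard A.X.left.Modules
      Nonempty (ShiftedHom
          (DerivedCategory.Q.obj (HodgeTheory.homComplex A.X.left (translationPullbackComplex A x E)
            ((HomologicalComplex.single A.X.left.Modules (ComplexShape.up ℤ) 0).obj (Modules.unitModule A.X.left))))
          (DerivedCategory.Q.obj (HodgeTheory.homComplex A.X.left E
            ((HomologicalComplex.single A.X.left.Modules (ComplexShape.up ℤ) 0).obj (Modules.unitModule A.X.left)))) k ≃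
        ShiftedHom (DerivedCategory.Q.obj E) (DerivedCategory.Q.obj (translationPullbackComplex A x E)) k)) :
    x ∈ extJumpLocus A (HodgeTheory.homComplex A.X.left E ((HomologicalComplex.single A.X.left.Modules (ComplexShape.up ℤ) 0).obj (Modules.unitModule A.X.left))) ↔
      x ∈ extJumpLocus A E := by
  have hx' : x⁻¹ = x := inv_eq_of_mul_eq_one_right hx
  rw [mem_extJumpLocus_dual_iff_of_duality A E hE x hdual, hx']

end NowhereDisplaceable

end Summit.HodgeConjecture.HodgeConjecture.Ring2.SemiregularRepresentatives

end
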